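import Mathlib
import Summits.CriticalPhenomena.Ising3DConformalLimit.Theorems.AnomalousForcesInteractionGaussianLimitIsFreeCollarCutoff
import HarnessLib

/-!
# A radial shell pair for the rigidity step of the crux `GaussianLimitIsFree`

Helper file for the crux `AnomalousForcesInteraction.GaussianLimitIsFree`
(item stmt-CriticalPhenomena-2601, line `registered`, stub `stub_radialShellPair`; theorem-only).
Notation in the docstrings: `E³ = EuclideanSpace ℝ (Fin 3)`, `e = EuclideanSpace.single 0 1`,
`U_u(x) = ∫ u(y)‖y − x‖^{-α} dy` (`Real.rpow`).

We take the radial bumps `uᵢ(y) = ψᵢ(‖y‖²)`, `ψ₁` a `ContDiffBump` on `ℝ` centred at `0`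
(`rOut = 1/32`), `ψ₂` centred at `25/64` (`rOut = 1/8`): `‖y‖² < 1/32` on `supp u₁` and
`17/64 < ‖y‖² < 33/64` on `supp u₂`.  The sub-namespace `RadialShellPair` has the generic facts:

* `exists_schwartz_radial` — `y ↦ ψ(‖y‖²)` is a nonnegative, isometry-invariant, compactly
  supported Schwartz map (`contDiff_norm_sq`, `HasCompactSupport.toSchwartzMap`);
* `integral_comp_linearIsometryEquiv` (`LinearIsometryEquiv.measurePreserving`), whence
  `rieszPotential_eq_of_norm_eq` (`U_u(x) = U_u(x')` for `‖x‖ = ‖x'‖`, via the reflection mapping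
  `x'` to `x`, `Submodule.reflection_sub`), `integral_mul_inner_eq_zero` (`∫ u⟨e,y⟩ = 0`, via
  `y ↦ −y`) and `integral_mul_inner_single_sq` (`∫ u⟨e,y⟩² = ∫ u‖y‖²/3`, via coordinate
  transpositions);
* `rieszPotential_pos` — `U_u(x) > 0` for `‖x‖ > 3/4` (`integral_pos_iff_support_of_nonneg`);
* `integrable_mul_rieszKernel` — `y ↦ u(y)‖y − x‖^{-α}` is integrable for every `x`, `α < 3`
  (`HasCompactSupport.convolutionExists_left`, `CollarCutoff.locallyIntegrable_rieszKernel`);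
* `exists_bump_integral_ne_zero` — a continuous `F` with `F x₀ ≠ 0` is detected by a small bump at
  `x₀`: `∫ F v ≠ 0`.

Continuity of the potentials is `CollarCutoff.contDiff_rieszPotential`, Fubini for the pairing is
`CollarCutoff.integral_integral_rieszKernel_swap`.  All statements are folklore.
-/

noncomputable section

namespace Summit.CriticalPhenomena.Ising3DConformalLimit.Cruxes.GaussianLimitIsFree.Birth

open MeasureTheory Set Filter Metric

namespace RadialShellPair

/-- **Radial Schwartz bumps.**  For a smooth bump `ψ` on `ℝ` centred at `c` and `R > 0` with
`c + ψ.rOut ≤ R²`, the radial profile `y ↦ ψ(‖y‖²)` on `ℝ³` is (the underlying function of) a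
real Schwartz map `u` with `tsupport u ⊆ closedBall 0 R`, compact support, invariance under all
linear isometries, `u ≥ 0`, and `u` continuous. [folklore] -/
theorem exists_schwartz_radial {c : ℝ} (ψ : ContDiffBump c) {R : ℝ} (hR : 0 < R)
    (hcR : c + ψ.rOut ≤ R ^ 2) :
    ∃ u : SchwartzMap (EuclideanSpace ℝ (Fin 3)) ℝ, (∀ y, u y = ψ (‖y‖ ^ 2)) ∧
      tsupport ⇑u ⊆ closedBall (0 : EuclideanSpace ℝ (Fin 3)) R ∧ HasCompactSupport ⇑u ∧
      (∀ (L : EuclideanSpace ℝ (Fin 3) ≃ₗᵢ[ℝ] EuclideanSpace ℝ (Fin 3))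
        (y : EuclideanSpace ℝ (Fin 3)), u (L y) = u y) ∧
      (0 ≤ ⇑u) ∧ Continuous ⇑u := by
  set f : EuclideanSpace ℝ (Fin 3) → ℝ := fun y => ψ (‖y‖ ^ 2) with hf
  have hsmooth : ContDiff ℝ (⊤ : ℕ∞) f := ψ.contDiff.comp (contDiff_norm_sq ℝ)
  have hzero : ∀ y : EuclideanSpace ℝ (Fin 3),
      y ∉ closedBall (0 : EuclideanSpace ℝ (Fin 3)) R → f y = 0 := by
    intro y hy
    rw [mem_closedBall, dist_zero_right, not_le] at hy
    apply ψ.zero_of_le_dist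
    rw [Real.dist_eq]
    have h1 : R ^ 2 < ‖y‖ ^ 2 := by nlinarith [norm_nonneg y]
    calc ψ.rOut ≤ ‖y‖ ^ 2 - c := by linarith
      _ ≤ |‖y‖ ^ 2 - c| := le_abs_self _
  have hcs : HasCompactSupport f := HasCompactSupport.intro (isCompact_closedBall 0 R) hzero
  refine ⟨hcs.toSchwartzMap hsmooth, fun y => rfl, ?_, hcs, fun L y => ?_, fun y => ψ.nonneg, ?_⟩
  · show tsupport f ⊆ _
    exact closure_minimal (fun y hy => by_contra fun h => hy (hzero y h)) isClosed_closedBall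
  · show f (L y) = f y
    simp only [hf, LinearIsometryEquiv.norm_map]
  · exact (hcs.toSchwartzMap hsmooth).continuous

/-- If `u = ψ(‖·‖²)` does not vanish at `y` then `‖y‖²` lies in the open support ball of the
bump `ψ` (`ContDiffBump.support_eq`). [folklore] -/
theorem norm_sq_mem_ball_of_ne_zero {c : ℝ} (ψ : ContDiffBump c)
    {u : SchwartzMap (EuclideanSpace ℝ (Fin 3)) ℝ} (hu : ∀ y, u y = ψ (‖y‖ ^ 2))
    {y : EuclideanSpace ℝ (Fin 3)} (hy : u y ≠ 0) : ‖y‖ ^ 2 ∈ ball c ψ.rOut := by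
  rw [hu] at hy
  rwa [← Function.mem_support, ψ.support_eq] at hy

/-- Lebesgue measure on `ℝ³` is invariant under linear isometries: `∫ g (L y) dy = ∫ g (y) dy`
(`LinearIsometryEquiv.measurePreserving`, `MeasurePreserving.integral_comp`). [folklore] -/
theorem integral_comp_linearIsometryEquiv
    (L : EuclideanSpace ℝ (Fin 3) ≃ₗᵢ[ℝ] EuclideanSpace ℝ (Fin 3))
    (g : EuclideanSpace ℝ (Fin 3) → ℝ) : ∫ y, g (L y) = ∫ y, g y :=
  L.measurePreserving.integral_comp L.toHomeomorph.measurableEmbedding g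

/-- **Riesz potentials of isometry-invariant functions are radial**: if `u (L y) = u y` for every
linear isometry `L` of `ℝ³` then `∫ u(y)‖y − x‖^{-α} dy = ∫ u(y)‖y − x'‖^{-α} dy` whenever
`‖x‖ = ‖x'‖` (change variables by the reflection mapping `x'` to `x`,
`Submodule.reflection_sub`). [folklore] -/
theorem rieszPotential_eq_of_norm_eq (u : EuclideanSpace ℝ (Fin 3) → ℝ)
    (hrad : ∀ (L : EuclideanSpace ℝ (Fin 3) ≃ₗᵢ[ℝ] EuclideanSpace ℝ (Fin 3))
      (y : EuclideanSpace ℝ (Fin 3)), u (L y) = u y)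
    (α : ℝ) {x x' : EuclideanSpace ℝ (Fin 3)} (h : ‖x‖ = ‖x'‖) :
    ∫ y, u y * ‖y - x‖ ^ (-α) = ∫ y, u y * ‖y - x'‖ ^ (-α) := by
  set R : EuclideanSpace ℝ (Fin 3) ≃ₗᵢ[ℝ] EuclideanSpace ℝ (Fin 3) :=
    (ℝ ∙ (x' - x))ᗮ.reflection with hR
  have hRx : R x' = x := Submodule.reflection_sub h.symm
  rw [← integral_comp_linearIsometryEquiv R (fun y => u y * ‖y - x‖ ^ (-α))]
  refine integral_congr_ae (Eventually.of_forall fun y => ?_)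
  simp only
  rw [hrad, ← hRx, ← map_sub, LinearIsometryEquiv.norm_map]

/-- **Odd moments of isometry-invariant functions vanish**: `∫ u(y)⟨e, y⟩ dy = 0` (substitute
`y ↦ −y`). [folklore] -/
theorem integral_mul_inner_eq_zero (u : EuclideanSpace ℝ (Fin 3) → ℝ)
    (hrad : ∀ (L : EuclideanSpace ℝ (Fin 3) ≃ₗᵢ[ℝ] EuclideanSpace ℝ (Fin 3))
      (y : EuclideanSpace ℝ (Fin 3)), u (L y) = u y)
    (e : EuclideanSpace ℝ (Fin 3)) : ∫ y, u y * inner ℝ e y = 0 := by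
  set L : EuclideanSpace ℝ (Fin 3) ≃ₗᵢ[ℝ] EuclideanSpace ℝ (Fin 3) :=
    LinearIsometryEquiv.neg ℝ with hL
  have hcomp := integral_comp_linearIsometryEquiv L (fun y => u y * inner ℝ e y)
  have h2 : ∫ y, (fun y => u y * inner ℝ e y) (L y) = -∫ y, u y * inner ℝ e y := by
    rw [← integral_neg]
    refine integral_congr_ae (Eventually.of_forall fun y => ?_)
    simp only
    rw [hrad L y, hL, LinearIsometryEquiv.coe_neg, inner_neg_right, mul_neg]
  simp only at hcomp h2
  linarith

/-- Second moments of an isometry-invariant function are the same in every coordinate: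
`∫ u(y) yᵢ² dy = ∫ u(y) y₀² dy` (the transposition of the coordinates `0` and `i` is a linear
isometry, `LinearIsometryEquiv.piLpCongrLeft`). [folklore] -/
theorem integral_mul_apply_sq_eq (u : EuclideanSpace ℝ (Fin 3) → ℝ)
    (hrad : ∀ (L : EuclideanSpace ℝ (Fin 3) ≃ₗᵢ[ℝ] EuclideanSpace ℝ (Fin 3))
      (y : EuclideanSpace ℝ (Fin 3)), u (L y) = u y)
    (i : Fin 3) :
    ∫ y : EuclideanSpace ℝ (Fin 3), u y * (y i) ^ 2 =
      ∫ y : EuclideanSpace ℝ (Fin 3), u y * (y 0) ^ 2 := by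
  set L : EuclideanSpace ℝ (Fin 3) ≃ₗᵢ[ℝ] EuclideanSpace ℝ (Fin 3) :=
    LinearIsometryEquiv.piLpCongrLeft 2 ℝ ℝ (Equiv.swap 0 i) with hL
  rw [← integral_comp_linearIsometryEquiv L (fun y => u y * (y 0) ^ 2)]
  refine integral_congr_ae (Eventually.of_forall fun y => ?_)
  simp only
  rw [hrad L y]
  congr 2

/-- **Radial second-moment identity**: for an isometry-invariant continuous compactly supported
`u` on `ℝ³` and `e = EuclideanSpace.single 0 1`, `∫ u(y)⟨e, y⟩² dy = (1/3) ∫ u(y)‖y‖² dy`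
(`⟨e, y⟩ = y₀`, `‖y‖² = Σᵢ yᵢ²`, and the three coordinate moments agree). [folklore] -/
theorem integral_mul_inner_single_sq (u : EuclideanSpace ℝ (Fin 3) → ℝ) (hc : Continuous u)
    (hcs : HasCompactSupport u)
    (hrad : ∀ (L : EuclideanSpace ℝ (Fin 3) ≃ₗᵢ[ℝ] EuclideanSpace ℝ (Fin 3))
      (y : EuclideanSpace ℝ (Fin 3)), u (L y) = u y) :
    ∫ y, u y * (inner ℝ (EuclideanSpace.single (0 : Fin 3) (1 : ℝ)) y) ^ 2 =
      (1 / 3) * ∫ y, u y * ‖y‖ ^ 2 := by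
  have h1 : ∀ y : EuclideanSpace ℝ (Fin 3),
      inner ℝ (EuclideanSpace.single (0 : Fin 3) (1 : ℝ)) y = y 0 := fun y => by
    simp [EuclideanSpace.inner_single_left]
  have hint : ∀ i : Fin 3, Integrable (fun y : EuclideanSpace ℝ (Fin 3) => u y * (y i) ^ 2) := by
    intro i
    refine Continuous.integrable_of_hasCompactSupport (hc.mul ?_) hcs.mul_right
    fun_prop
  simp_rw [h1, EuclideanSpace.real_norm_sq_eq, Finset.mul_sum]
  rw [integral_finsetSum _ (fun i _ => hint i)]
  simp_rw [integral_mul_apply_sq_eq u hrad]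
  simp only [Finset.sum_const, Finset.card_univ, Fintype.card_fin, nsmul_eq_mul]
  push_cast
  ring

/-- **Strict positivity of Riesz potentials**: if `u ≥ 0` is continuous, supported in
`closedBall 0 (3/4)`, `u y₀ ≠ 0`, and `y ↦ u(y)‖y − x‖^{-α}` is integrable, then
`∫ u(y)‖y − x‖^{-α} dy > 0` for every `x` with `‖x‖ > 3/4` (the integrand is nonnegative, and
positive on the support of `u` — a nonempty open set — where `y ≠ x`). [folklore] -/
theorem rieszPotential_pos (u : EuclideanSpace ℝ (Fin 3) → ℝ) (hc : Continuous u) (h0 : 0 ≤ u)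
    (hsupp : tsupport u ⊆ closedBall (0 : EuclideanSpace ℝ (Fin 3)) (3 / 4))
    {y₀ : EuclideanSpace ℝ (Fin 3)} (hy₀ : u y₀ ≠ 0) (α : ℝ)
    {x : EuclideanSpace ℝ (Fin 3)} (hx : 3 / 4 < ‖x‖)
    (hint : Integrable (fun y => u y * ‖y - x‖ ^ (-α))) :
    0 < ∫ y, u y * ‖y - x‖ ^ (-α) := by
  have hg0 : 0 ≤ fun y => u y * ‖y - x‖ ^ (-α) := fun y =>
    mul_nonneg (h0 y) (Real.rpow_nonneg (norm_nonneg _) _)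
  refine (integral_pos_iff_support_of_nonneg hg0 hint).2 ?_
  have hsub : Function.support u ⊆ Function.support fun y => u y * ‖y - x‖ ^ (-α) := by
    intro y hy
    rw [Function.mem_support] at hy ⊢
    have hy' : y ∈ closedBall (0 : EuclideanSpace ℝ (Fin 3)) (3 / 4) :=
      hsupp (subset_tsupport _ hy)
    rw [mem_closedBall, dist_zero_right] at hy'
    have hne : y - x ≠ 0 := sub_ne_zero.2 (by rintro rfl; linarith)
    exact mul_ne_zero hy (Real.rpow_pos_of_pos (norm_pos_iff.2 hne) _).ne'
  exact lt_of_lt_of_le (hc.isOpen_support.measure_pos volume ⟨y₀, hy₀⟩) (measure_mono hsub)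

/-- **Integrability of the Riesz-potential integrand**: for a compactly supported real Schwartz
`u` on `ℝ³`, `α < 3` and every `x`, `y ↦ u(y)‖y − x‖^{-α}` is integrable (existence of the
convolution of a continuous compactly supported function with the locally integrable kernel,
`HasCompactSupport.convolutionExists_left`). [folklore] -/
theorem integrable_mul_rieszKernel (u : SchwartzMap (EuclideanSpace ℝ (Fin 3)) ℝ)
    (hu : HasCompactSupport ⇑u) {α : ℝ} (h3 : α < 3) (x : EuclideanSpace ℝ (Fin 3)) :
    Integrable (fun y => u y * ‖y - x‖ ^ (-α)) := by
  have h := hu.convolutionExists_left (ContinuousLinearMap.mul ℝ ℝ) u.continuous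
    (CollarCutoff.locallyIntegrable_rieszKernel h3) x
  refine h.congr (Eventually.of_forall fun t => ?_)
  simp only [ContinuousLinearMap.mul_apply']
  rw [norm_sub_rev]

/-- **A bump detects a positive value of a continuous function**: if `F` is continuous on `ℝ³`
with `F x₀ > 0` then for every `ρ > 0` there is a smooth bump `v ≥ 0` (as a Schwartz map) with
`tsupport v ⊆ ball x₀ ρ` and `∫ F v > 0` (choose the bump so small that `F > F(x₀)/2` on its
support). [folklore] -/
theorem exists_bump_integral_pos {F : EuclideanSpace ℝ (Fin 3) → ℝ} (hF : Continuous F)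
    {x₀ : EuclideanSpace ℝ (Fin 3)} (hx₀ : 0 < F x₀) {ρ : ℝ} (hρ : 0 < ρ) :
    ∃ v : SchwartzMap (EuclideanSpace ℝ (Fin 3)) ℝ,
      tsupport ⇑v ⊆ ball x₀ ρ ∧ 0 < ∫ y, F y * v y := by
  obtain ⟨δ, hδ, hδF⟩ := Metric.continuousAt_iff.1 hF.continuousAt (F x₀ / 2) (by positivity)
  set r : ℝ := min δ ρ / 2 with hr
  have hr0 : 0 < r := by positivity
  have hrδ : r < δ := by have := min_le_left δ ρ; rw [hr]; linarith
  have hrρ : r < ρ := by have := min_le_right δ ρ; rw [hr]; linarith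
  let ψ : ContDiffBump x₀ := ⟨r / 2, r, by positivity, by linarith⟩
  refine ⟨ψ.hasCompactSupport.toSchwartzMap ψ.contDiff, ?_, ?_⟩
  · show tsupport (ψ : EuclideanSpace ℝ (Fin 3) → ℝ) ⊆ _
    rw [ψ.tsupport_eq]
    exact closedBall_subset_ball hrρ
  · have hpt : ∀ y, (F x₀ / 2) * ψ y ≤ F y * ψ y := by
      intro y
      by_cases hy : y ∈ ball x₀ r
      · have hFy : dist (F y) (F x₀) < F x₀ / 2 := hδF (lt_trans (mem_ball.1 hy) hrδ)
        rw [Real.dist_eq] at hFy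
        have : F x₀ / 2 < F y := by linarith [neg_lt_of_abs_lt hFy]
        exact mul_le_mul_of_nonneg_right this.le ψ.nonneg
      · rw [ψ.zero_of_le_dist (not_lt.1 (mt mem_ball.2 hy))]
        simp
    have hint2 : Integrable (fun y => F y * ψ y) :=
      Continuous.integrable_of_hasCompactSupport (hF.mul ψ.continuous) ψ.hasCompactSupport.mul_left
    calc (0 : ℝ) < (F x₀ / 2) * ∫ y, ψ y := by
          have := ψ.integral_pos (μ := (volume : Measure (EuclideanSpace ℝ (Fin 3))))
          positivity
      _ = ∫ y, (F x₀ / 2) * ψ y := (integral_const_mul _ _).symm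
      _ ≤ ∫ y, F y * ψ y := integral_mono ((ψ.integrable).const_mul _) hint2 hpt

/-- **A bump detects a nonzero value of a continuous function**: if `F` is continuous on `ℝ³` with
`F x₀ ≠ 0` then for every `ρ > 0` some Schwartz `v` with `tsupport v ⊆ ball x₀ ρ` has `∫ F v ≠ 0`
(`exists_bump_integral_pos` for `F` or `−F`). [folklore] -/
theorem exists_bump_integral_ne_zero {F : EuclideanSpace ℝ (Fin 3) → ℝ} (hF : Continuous F)
    {x₀ : EuclideanSpace ℝ (Fin 3)} (hx₀ : F x₀ ≠ 0) {ρ : ℝ} (hρ : 0 < ρ) :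
    ∃ v : SchwartzMap (EuclideanSpace ℝ (Fin 3)) ℝ,
      tsupport ⇑v ⊆ ball x₀ ρ ∧ (∫ y, F y * v y) ≠ 0 := by
  rcases lt_or_gt_of_ne hx₀ with hneg | hpos
  · obtain ⟨v, hv, hint⟩ :=
      exists_bump_integral_pos (F := fun x => -F x) hF.neg (by simpa using hneg) hρ
    refine ⟨v, hv, ?_⟩
    have : ∫ y, (fun x => -F x) y * v y = -∫ y, F y * v y := by
      rw [← integral_neg]
      exact integral_congr_ae (Eventually.of_forall fun y => by simp)
    rw [this] at hint
    linarith
  · obtain ⟨v, hv, hint⟩ := exists_bump_integral_pos hF hpos hρ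
    exact ⟨v, hv, hint.ne'⟩

end RadialShellPair

open RadialShellPair

/-- **Stub 3.5 of the line `registered` (a radial shell pair).**  For `1/2 < Δ ≤ 1` there are real
Schwartz `u₁, u₂` on `ℝ³` — the radial bumps `ψ₁(‖y‖²)`, `ψ₂(‖y‖²)` with `ψ₁` a smooth bump on `ℝ`
centred at `0` (`rIn = 1/64`, `rOut = 1/32`) and `ψ₂` centred at `25/64` (`rIn = 1/16`, `rOut = 1/8`)
— such that, with `Uᵢ(x) = ∫ uᵢ(y)‖y − x‖^{-2Δ}dy` and `e = EuclideanSpace.single 0 1`: both supports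
lie in `closedBall 0 (3/4)`; `∫u₁ > 0`; `∫u₁‖y‖² ≤ ∫u₁/16` and `∫u₂/4 ≤ ∫u₂‖y‖²` (support and
sign); `Uᵢ(e) > 0`; integrability of `y ↦ uᵢ(y)‖y − x‖^{-2Δ}` for every `x` (`2Δ < 3`); constancy of
`Uᵢ` on the unit sphere (reflection invariance); `∫uᵢ⟨e,y⟩ = 0`, `∫uᵢ⟨e,y⟩² = ∫uᵢ‖y‖²/3`; and
detectability of the exterior potential of `u₁ − λu₂`: if `U₁(t₀e) − λU₂(t₀e) ≠ 0` for some
`t₀ > 1` then `∫∫ (u₁ − λu₂)(x)‖x − y‖^{-2Δ}v(y) dy dx ≠ 0` for some Schwartz `v` supported outside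
the closed unit ball (continuity of the potentials, a bump at `t₀e`, Fubini). [folklore] -/
theorem stub_radialShellPair :
    ∀ Δ : ℝ, 1 / 2 < Δ → Δ ≤ 1 →
      ∃ u₁ u₂ : SchwartzMap (EuclideanSpace ℝ (Fin 3)) ℝ,
        tsupport ⇑u₁ ⊆ Metric.closedBall (0 : EuclideanSpace ℝ (Fin 3)) (3 / 4) ∧
        tsupport ⇑u₂ ⊆ Metric.closedBall (0 : EuclideanSpace ℝ (Fin 3)) (3 / 4) ∧
        (0 < ∫ y, u₁ y) ∧
        (∫ y, u₁ y * ‖y‖ ^ 2 ≤ (1 / 16) * ∫ y, u₁ y) ∧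
        ((1 / 4) * ∫ y, u₂ y ≤ ∫ y, u₂ y * ‖y‖ ^ 2) ∧
        (0 < ∫ y, u₁ y * ‖y - EuclideanSpace.single (0 : Fin 3) (1 : ℝ)‖ ^ (-(2 * Δ))) ∧
        (0 < ∫ y, u₂ y * ‖y - EuclideanSpace.single (0 : Fin 3) (1 : ℝ)‖ ^ (-(2 * Δ))) ∧
        (∀ x : EuclideanSpace ℝ (Fin 3),
          MeasureTheory.Integrable (fun y => u₁ y * ‖y - x‖ ^ (-(2 * Δ))) ∧
          MeasureTheory.Integrable (fun y => u₂ y * ‖y - x‖ ^ (-(2 * Δ)))) ∧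
        (∀ x : EuclideanSpace ℝ (Fin 3), ‖x‖ = 1 →
          (∫ y, u₁ y * ‖y - x‖ ^ (-(2 * Δ))) =
              ∫ y, u₁ y * ‖y - EuclideanSpace.single (0 : Fin 3) (1 : ℝ)‖ ^ (-(2 * Δ)) ∧
          (∫ y, u₂ y * ‖y - x‖ ^ (-(2 * Δ))) =
              ∫ y, u₂ y * ‖y - EuclideanSpace.single (0 : Fin 3) (1 : ℝ)‖ ^ (-(2 * Δ))) ∧
        (∫ y, u₁ y * inner ℝ (EuclideanSpace.single (0 : Fin 3) (1 : ℝ)) y = 0) ∧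
        (∫ y, u₂ y * inner ℝ (EuclideanSpace.single (0 : Fin 3) (1 : ℝ)) y = 0) ∧
        (∫ y, u₁ y * (inner ℝ (EuclideanSpace.single (0 : Fin 3) (1 : ℝ)) y) ^ 2 =
            (1 / 3) * ∫ y, u₁ y * ‖y‖ ^ 2) ∧
        (∫ y, u₂ y * (inner ℝ (EuclideanSpace.single (0 : Fin 3) (1 : ℝ)) y) ^ 2 =
            (1 / 3) * ∫ y, u₂ y * ‖y‖ ^ 2) ∧
        (∀ (lam t₀ : ℝ), 1 < t₀ →
          (∫ y, u₁ y * ‖y - t₀ • EuclideanSpace.single (0 : Fin 3) (1 : ℝ)‖ ^ (-(2 * Δ))) -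
              lam * (∫ y, u₂ y * ‖y - t₀ • EuclideanSpace.single (0 : Fin 3) (1 : ℝ)‖ ^ (-(2 * Δ))) ≠ 0 →
          ∃ v : SchwartzMap (EuclideanSpace ℝ (Fin 3)) ℝ,
            tsupport ⇑v ⊆ (Metric.closedBall (0 : EuclideanSpace ℝ (Fin 3)) 1)ᶜ ∧
            (∫ x, ∫ y, (u₁ - lam • u₂) x * ‖x - y‖ ^ (-(2 * Δ)) * v y) ≠ 0) := by
  intro Δ hΔ1 hΔ2
  have hα3 : 2 * Δ < 3 := by linarith
  have hα0 : 0 ≤ 2 * Δ := by linarith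
  -- the two radial bumps
  let ψ₁ : ContDiffBump (0 : ℝ) := ⟨1 / 64, 1 / 32, by norm_num, by norm_num⟩
  let ψ₂ : ContDiffBump (25 / 64 : ℝ) := ⟨1 / 16, 1 / 8, by norm_num, by norm_num⟩
  obtain ⟨u₁, hu₁, hsupp₁, hcs₁, hrad₁, hnn₁, hcont₁⟩ :=
    exists_schwartz_radial ψ₁ (R := 3 / 4) (by norm_num) (by norm_num)
  obtain ⟨u₂, hu₂, hsupp₂, hcs₂, hrad₂, hnn₂, hcont₂⟩ :=
    exists_schwartz_radial ψ₂ (R := 3 / 4) (by norm_num) (by norm_num)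
  set e : EuclideanSpace ℝ (Fin 3) := EuclideanSpace.single (0 : Fin 3) (1 : ℝ) with he
  have he1 : ‖e‖ = 1 := by rw [he]; simp
  -- `u₁ 0 = 1` and `u₂ ((5/8) e) = 1`
  have hu₁0 : u₁ 0 ≠ 0 := by
    rw [hu₁, norm_zero, ψ₁.one_of_mem_closedBall] <;> simp [ψ₁.rIn_pos.le]
  have hu₂0 : u₂ ((5 / 8 : ℝ) • e) ≠ 0 := by
    have hn : ‖(5 / 8 : ℝ) • e‖ ^ 2 = 25 / 64 := by
      rw [norm_smul, he1, Real.norm_eq_abs]; norm_num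
    rw [hu₂, hn, ψ₂.one_of_mem_closedBall] <;> simp [ψ₂.rIn_pos.le]
  -- integrability of the potentials' integrands
  have hint₁ : ∀ x, Integrable (fun y => u₁ y * ‖y - x‖ ^ (-(2 * Δ))) :=
    fun x => integrable_mul_rieszKernel u₁ hcs₁ hα3 x
  have hint₂ : ∀ x, Integrable (fun y => u₂ y * ‖y - x‖ ^ (-(2 * Δ))) :=
    fun x => integrable_mul_rieszKernel u₂ hcs₂ hα3 x
  refine ⟨u₁, u₂, hsupp₁, hsupp₂, ?_, ?_, ?_, ?_, ?_, fun x => ⟨hint₁ x, hint₂ x⟩, ?_,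
    integral_mul_inner_eq_zero u₁ hrad₁ e, integral_mul_inner_eq_zero u₂ hrad₂ e,
    integral_mul_inner_single_sq u₁ hcont₁ hcs₁ hrad₁,
    integral_mul_inner_single_sq u₂ hcont₂ hcs₂ hrad₂, ?_⟩
  · -- `∫ u₁ > 0`
    exact (integral_pos_iff_support_of_nonneg hnn₁ u₁.integrable).2
      (hcont₁.isOpen_support.measure_pos volume ⟨0, hu₁0⟩)
  · -- `∫ u₁ ‖y‖² ≤ ∫ u₁ / 16`: `‖y‖² < 1/32` on the support of `u₁ ≥ 0`
    rw [← integral_const_mul]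
    refine integral_mono ?_ (u₁.integrable.const_mul _) fun y => ?_
    · exact Continuous.integrable_of_hasCompactSupport (hcont₁.mul (continuous_norm.pow 2))
        hcs₁.mul_right
    · by_cases hy : u₁ y = 0
      · simp [hy]
      · have hm := norm_sq_mem_ball_of_ne_zero ψ₁ hu₁ hy
        have hr : ψ₁.rOut = 1 / 32 := rfl
        rw [mem_ball, Real.dist_eq, sub_zero, abs_lt, hr] at hm
        have h16 : ‖y‖ ^ 2 ≤ 1 / 16 := by linarith [hm.2]
        have h0 : (0 : ℝ) ≤ u₁ y := hnn₁ y
        calc u₁ y * ‖y‖ ^ 2 ≤ u₁ y * (1 / 16) := mul_le_mul_of_nonneg_left h16 h0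
          _ = 1 / 16 * u₁ y := by ring
  · -- `∫ u₂ / 4 ≤ ∫ u₂ ‖y‖²`: `‖y‖² > 17/64` on the support of `u₂ ≥ 0`
    rw [← integral_const_mul]
    refine integral_mono (u₂.integrable.const_mul _) ?_ fun y => ?_
    · exact Continuous.integrable_of_hasCompactSupport (hcont₂.mul (continuous_norm.pow 2))
        hcs₂.mul_right
    · by_cases hy : u₂ y = 0
      · simp [hy]
      · have hm := norm_sq_mem_ball_of_ne_zero ψ₂ hu₂ hy
        have hr : ψ₂.rOut = 1 / 8 := rfl
        rw [mem_ball, Real.dist_eq, abs_lt, hr] at hm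
        have h4 : 1 / 4 ≤ ‖y‖ ^ 2 := by linarith [hm.1]
        have h0 : (0 : ℝ) ≤ u₂ y := hnn₂ y
        calc 1 / 4 * u₂ y = u₂ y * (1 / 4) := by ring
          _ ≤ u₂ y * ‖y‖ ^ 2 := mul_le_mul_of_nonneg_left h4 h0
  · -- `U₁(e) > 0`
    exact rieszPotential_pos u₁ hcont₁ hnn₁ hsupp₁ hu₁0 (2 * Δ) (by rw [he1]; norm_num) (hint₁ e)
  · -- `U₂(e) > 0`
    exact rieszPotential_pos u₂ hcont₂ hnn₂ hsupp₂ hu₂0 (2 * Δ) (by rw [he1]; norm_num) (hint₂ e)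
  · -- constancy on the unit sphere
    intro x hx
    have hxe : ‖x‖ = ‖e‖ := by rw [hx, he1]
    exact ⟨rieszPotential_eq_of_norm_eq u₁ hrad₁ (2 * Δ) hxe,
      rieszPotential_eq_of_norm_eq u₂ hrad₂ (2 * Δ) hxe⟩
  · -- detectability of the exterior potential of `u₁ - lam • u₂`
    intro lam t₀ ht₀ hF
    set F : EuclideanSpace ℝ (Fin 3) → ℝ := fun x =>
      (∫ y, u₁ y * ‖y - x‖ ^ (-(2 * Δ))) - lam * ∫ y, u₂ y * ‖y - x‖ ^ (-(2 * Δ)) with hFdef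
    have hFc : Continuous F :=
      (CollarCutoff.contDiff_rieszPotential u₁ hcs₁ hα3 (n := 0)).continuous.sub
        (continuous_const.mul (CollarCutoff.contDiff_rieszPotential u₂ hcs₂ hα3 (n := 0)).continuous)
    have hF0 : F (t₀ • e) ≠ 0 := hF
    obtain ⟨v, hvsupp, hvint⟩ := exists_bump_integral_ne_zero hFc hF0 (ρ := t₀ - 1) (by linarith)
    refine ⟨v, fun y hy => ?_, ?_⟩
    · -- `ball (t₀ e) (t₀ - 1)` misses the closed unit ball
      have hy' := hvsupp hy
      rw [mem_ball, dist_eq_norm] at hy'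
      rw [mem_compl_iff, mem_closedBall, dist_zero_right, not_le]
      have hte : ‖t₀ • e‖ = t₀ := by
        rw [norm_smul, he1, mul_one, Real.norm_eq_abs, abs_of_pos (by linarith)]
      have := norm_sub_norm_le (t₀ • e) y
      rw [hte, norm_sub_rev] at this
      linarith
    · -- Fubini, then the inner integral is `F y`
      rw [CollarCutoff.integral_integral_rieszKernel_swap (u₁ - lam • u₂) v hα0 hα3]
      have hinner : ∀ y, ∫ x, (u₁ - lam • u₂) x * ‖x - y‖ ^ (-(2 * Δ)) = F y := by
        intro y
        simp only [sub_apply, smul_apply, smul_eq_mul, sub_mul, mul_assoc]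
        rw [integral_sub (hint₁ y) ((hint₂ y).const_mul lam), integral_const_mul]
      simp_rw [hinner]
      exact hvint

end Summit.CriticalPhenomena.Ising3DConformalLimit.Cruxes.GaussianLimitIsFree.Birth

end
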